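import Mathlib
import Summits.ValiantsHypothesis.ValiantsHypothesis.Theorems.LacunarySymmetroidMatrixDescartesThreeLetters
import Summits.ValiantsHypothesis.ValiantsHypothesis.Theorems.LacunarySymmetroidMatrixDescartesTwoBlockLimit

/-!
# `MatrixDescartes` (stmt-ValiantsHypothesis-18050) — THE TWO-STEP FLAG AT INFINITY, KIT: the top letter in its eigenbasis,
# the polynomial congruent family `K(s)`, its value `D ⊕ diag(λ|_{Zᶜ})` at `s = 0`, and the congruences
# `K(s) = Λ(UᵀG(s)U)Λ`, `G(s) = x^{−d_{l₁}}F(x)`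

HONEST FRAMING.  Cell `pub-symmetroid`, seat `val-sym-mdr-p2` (gen 21); helper file `--supports` the crux
`Theses.LacunarySymmetroid.MatrixDescartes` (OPEN), NO closure claim; extends the tree's END INERTIA LAW
`Inertia.eventually_atTop_indices_eq` (which needs a NON-SINGULAR top letter) by one flag step, with the technique of
`…TwoBlockLimit` (a polynomial-in-`s` congruent family with non-singular limit).  General bookkeeping for the lineage's
inertia calculus (window laws, index formula, parity law) on pencils whose extreme letters are degenerate (rank one, as on
the census extremisers); nothing here bears on the crux in its window, `stub_twoSided`, `DoorA26` / `DoorA34`, registers,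
or `VP ≠ VNP`.

SETTING.  Real symmetric letters `S_l`, a unique top exponent `d_{l₁}` and a unique second exponent `d_{l₂} < d_{l₁}` (all
other `d_l < d_{l₂}`), gap `g = d_{l₁} − d_{l₂}`; `U` the eigenvector matrix of `S_{l₁}` (`UᵀS_{l₁}U = diag λ`), `Z = {i : λᵢ = 0}`
(an orthonormal basis of `ker S_{l₁}`), and `D = (UᵀS_{l₂}U)|_{Z×Z}` the COMPRESSION of `S_{l₂}` to `ker S_{l₁}`.

* `rescaledPencil` family `G(s) = Σ_l s^{2(d_{l₁}−d_l)} S_l` (`= x^{−d_{l₁}}F(x)` at `x = s⁻²`), `M(s) = UᵀG(s)U`, and the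
  congruent POLYNOMIAL family `K(s)ᵢⱼ = [i=j]λᵢ + Σ_{l≠l₁} s^{2(d_{l₁}−d_l) − g[i∈Z] − g[j∈Z]}(UᵀS_lU)ᵢⱼ = (Λ M(s) Λ)ᵢⱼ`,
  `Λ = diag(s^{−g} on Z, 1 off Z)`; `K(0)` is `D ⊕ diag(λ|_{Zᶜ})` up to the re-indexing `Z ⊕ Zᶜ ≃ Fin m`.
* `indices_K_zero`, `det_K_zero_ne_zero` — `ν(K(0)) = ν(S_{l₁}) + ν(D)`, `π(K(0)) = π(S_{l₁}) + π(D)`, `det K(0) ≠ 0`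
  when `det D ≠ 0`; `K_eq_conj` / `conj_eq_K` / `rescaledPencil_eq_smul` — the congruences.  The theorem itself
  (`flag_twoStep_indices_eq`) is the companion file `…FlagTwoStep`.

[folklore] (Sylvester's law of inertia; continuity of the spectrum).  Axioms `propext`, `Classical.choice`, `Quot.sound`.
No definitions.
-/

-- layout Summits/ValiantsHypothesis/ValiantsHypothesis forces the duplicated namespace component
set_option linter.dupNamespace false

namespace Summit.ValiantsHypothesis.ValiantsHypothesis.Theorems.LacunarySymmetroidMatrixDescartes

open Polynomial Matrix Finset
open scoped BigOperators Topology

namespace Inertia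

section FlagTwoStep

variable {m K : ℕ} (d : Fin K → ℕ) (S : Fin K → Matrix (Fin m) (Fin m) ℝ) (hS : ∀ l, (S l).IsHermitian) (l₁ l₂ : Fin K)

/-- the eigenvector matrix of the top letter (file-local notation) -/
local notation3 (prettyPrint := false) "𝕌₁" => ((hS l₁).eigenvectorUnitary : Matrix (Fin m) (Fin m) ℝ)

/-- the eigenvalues of the top letter (file-local notation) -/
local notation3 (prettyPrint := false) "λ₁" => (hS l₁).eigenvalues

/-- the gap `g = d_{l₁} − d_{l₂}` (file-local notation) -/
local notation3 (prettyPrint := false) "𝕘" => (d l₁ - d l₂)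

/-- the exponent of `s` at entry `(i, j)` of letter `l` in the rescaled family (file-local notation) -/
local notation3 (prettyPrint := false) "𝕟[" l ", " i ", " j "]" =>
  (2 * (d l₁ - d l) - (if λ₁ i = 0 then 𝕘 else 0) - (if λ₁ j = 0 then 𝕘 else 0))

/-- the polynomial family `K(s)` (file-local notation) -/
local notation3 (prettyPrint := false) "𝕂[" s "]" =>
  (Matrix.of fun (i j : Fin m) => (if i = j then λ₁ i else 0)
    + ∑ l ∈ Finset.univ.erase l₁, (s : ℝ) ^ (𝕟[l, i, j]) * ((𝕌₁)ᵀ * S l * 𝕌₁) i j)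

/-- the rescaled pencil `G(s) = Σ_l s^{2(d_{l₁} − d_l)} S_l` (file-local notation) -/
local notation3 (prettyPrint := false) "𝔾[" s "]" => (∑ l, (s : ℝ) ^ (2 * (d l₁ - d l)) • S l)

/-- the compression of `S_{l₂}` to `ker S_{l₁}` in the eigenbasis (file-local notation) -/
local notation3 (prettyPrint := false) "𝔻" =>
  (((𝕌₁)ᵀ * S l₂ * 𝕌₁).submatrix (fun i : {i : Fin m // λ₁ i = 0} => i.1) (fun i : {i : Fin m // λ₁ i = 0} => i.1))

/-! ## §1  The top letter in its eigenbasis -/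

/-- `UᵀU = 1` for the eigenvector matrix. [folklore] -/
theorem eigU_transpose_mul_self : (𝕌₁)ᵀ * 𝕌₁ = 1 := by
  have h := Unitary.coe_star_mul_self (hS l₁).eigenvectorUnitary
  rwa [Matrix.star_eq_conjTranspose, Matrix.conjTranspose_eq_transpose_of_trivial] at h

/-- `UUᵀ = 1`. [folklore] -/
theorem eigU_mul_transpose_self : 𝕌₁ * (𝕌₁)ᵀ = 1 :=
  mul_eq_one_comm.1 (eigU_transpose_mul_self S hS l₁)

/-- `UᵀS_{l₁}U = diag λ`. [folklore] -/
theorem eigU_conj_top : (𝕌₁)ᵀ * S l₁ * 𝕌₁ = Matrix.diagonal (λ₁) := by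
  have hspec : S l₁ = 𝕌₁ * Matrix.diagonal (λ₁) * star 𝕌₁ := by
    simpa [Unitary.conjStarAlgAut_apply] using (hS l₁).spectral_theorem
  rw [Matrix.star_eq_conjTranspose, Matrix.conjTranspose_eq_transpose_of_trivial] at hspec
  have h1 := eigU_transpose_mul_self S hS l₁
  calc (𝕌₁)ᵀ * S l₁ * 𝕌₁ = (𝕌₁)ᵀ * (𝕌₁ * Matrix.diagonal (λ₁) * (𝕌₁)ᵀ) * 𝕌₁ := by rw [← hspec]
    _ = ((𝕌₁)ᵀ * 𝕌₁) * Matrix.diagonal (λ₁) * ((𝕌₁)ᵀ * 𝕌₁) := by simp only [Matrix.mul_assoc]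
    _ = Matrix.diagonal (λ₁) := by rw [h1, Matrix.one_mul, Matrix.mul_one]

/-- The conjugated letters are symmetric. [folklore] -/
theorem isSymm_eigU_conj (l : Fin K) : ((𝕌₁)ᵀ * S l * 𝕌₁).IsSymm :=
  GramDual.isSymm_conj (GramDual.isSymm_of_isHermitian_real (hS l)) _

/-- The compression `D` is hermitian. [folklore] -/
theorem isHermitian_compression : (𝔻).IsHermitian :=
  (isHermitian_of_isSymm (isSymm_eigU_conj S hS l₁ l₂)).submatrix _

/-! ## §2  The polynomial family `K(s)`: symmetry, continuity, value at `0` -/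

/-- `K(s)` is symmetric. [folklore] -/
theorem isHermitian_K (s : ℝ) : (𝕂[s]).IsHermitian := by
  refine isHermitian_of_isSymm ?_
  unfold Matrix.IsSymm
  ext i j
  simp only [Matrix.transpose_apply, Matrix.of_apply]
  congr 1
  · by_cases h : i = j
    · subst h; rfl
    · rw [if_neg h, if_neg (Ne.symm h)]
  · refine Finset.sum_congr rfl fun l _ => ?_
    rw [(isSymm_eigU_conj S hS l₁ l).apply j i, Nat.sub_right_comm]

/-- `K` has continuous (polynomial) entries. [folklore] -/
theorem continuous_K (i j : Fin m) : Continuous fun s : ℝ => (𝕂[s]) i j := by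
  have h : (fun s : ℝ => (𝕂[s]) i j)
      = fun s => (if i = j then λ₁ i else 0) + ∑ l ∈ Finset.univ.erase l₁, s ^ (𝕟[l, i, j]) * ((𝕌₁)ᵀ * S l * 𝕌₁) i j := by
    funext s; rfl
  rw [h]
  exact continuous_const.add (continuous_finsetSum _ fun l _ => (continuous_pow _).mul continuous_const)

/-- **`K(0)` re-indexed along `Z ⊕ Zᶜ` is `D ⊕ diag(λ|_{Zᶜ})`** (`d_{l₂} < d_{l₁}`, all other exponents `< d_{l₂}`). [folklore] -/
theorem K_zero_submatrix (h12 : d l₂ < d l₁) (hsec : ∀ l, l ≠ l₁ → l ≠ l₂ → d l < d l₂) :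
    (𝕂[(0 : ℝ)]).submatrix (Equiv.sumCompl fun i : Fin m => λ₁ i = 0) (Equiv.sumCompl fun i : Fin m => λ₁ i = 0)
      = Matrix.fromBlocks (𝔻) 0 0 (Matrix.diagonal fun i : {i : Fin m // ¬ λ₁ i = 0} => λ₁ i.1) := by
  classical
  have hl₂ : l₂ ∈ Finset.univ.erase l₁ := Finset.mem_erase.2 ⟨fun h => by rw [h] at h12; exact lt_irrefl _ h12, Finset.mem_univ _⟩
  -- the sum at `s = 0`: only `l = l₂` with both indices in `Z` survives
  have hsum : ∀ i j : Fin m, ∑ l ∈ Finset.univ.erase l₁, (0 : ℝ) ^ (𝕟[l, i, j]) * ((𝕌₁)ᵀ * S l * 𝕌₁) i j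
      = if λ₁ i = 0 ∧ λ₁ j = 0 then ((𝕌₁)ᵀ * S l₂ * 𝕌₁) i j else 0 := by
    intro i j
    rw [Finset.sum_eq_single_of_mem l₂ hl₂ (fun l hl hne => by
      have hl1 : l ≠ l₁ := (Finset.mem_erase.1 hl).1
      have hlt : d l < d l₂ := hsec l hl1 hne
      have hpos : 𝕟[l, i, j] ≠ 0 := by split_ifs <;> omega
      rw [zero_pow hpos, zero_mul])]
    have hval : (0 : ℝ) ^ (𝕟[l₂, i, j]) = if (λ₁ i = 0 ∧ λ₁ j = 0) then 1 else 0 := by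
      by_cases h1 : λ₁ i = 0 <;> by_cases h2 : λ₁ j = 0
      · rw [if_pos (show λ₁ i = 0 ∧ λ₁ j = 0 from ⟨h1, h2⟩)]
        have h0 : 𝕟[l₂, i, j] = 0 := by rw [if_pos h1, if_pos h2]; omega
        rw [h0, pow_zero]
      · rw [if_neg (show ¬ (λ₁ i = 0 ∧ λ₁ j = 0) from fun h => h2 h.2)]
        have h0 : 𝕟[l₂, i, j] ≠ 0 := by rw [if_pos h1, if_neg h2]; omega
        rw [zero_pow h0]
      · rw [if_neg (show ¬ (λ₁ i = 0 ∧ λ₁ j = 0) from fun h => h1 h.1)]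
        have h0 : 𝕟[l₂, i, j] ≠ 0 := by rw [if_neg h1, if_pos h2]; omega
        rw [zero_pow h0]
      · rw [if_neg (show ¬ (λ₁ i = 0 ∧ λ₁ j = 0) from fun h => h1 h.1)]
        have h0 : 𝕟[l₂, i, j] ≠ 0 := by rw [if_neg h1, if_neg h2]; omega
        rw [zero_pow h0]
    rw [hval, ite_mul, one_mul, zero_mul]
  ext a b
  rcases a with a | a <;> rcases b with b | b
  · rw [Matrix.submatrix_apply, Equiv.sumCompl_apply_inl, Equiv.sumCompl_apply_inl, Matrix.fromBlocks_apply₁₁,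
      Matrix.of_apply, hsum, if_pos (show λ₁ a.1 = 0 ∧ λ₁ b.1 = 0 from ⟨a.2, b.2⟩), Matrix.submatrix_apply]
    by_cases hab : a.1 = b.1
    · rw [if_pos hab, show λ₁ a.1 = 0 from a.2, zero_add]
    · rw [if_neg hab, zero_add]
  · rw [Matrix.submatrix_apply, Equiv.sumCompl_apply_inl, Equiv.sumCompl_apply_inr, Matrix.fromBlocks_apply₁₂,
      Matrix.of_apply, hsum, if_neg (show ¬ (λ₁ a.1 = 0 ∧ λ₁ b.1 = 0) from fun h => b.2 h.2), Matrix.zero_apply,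
      if_neg (show ¬ (a.1 = b.1) from fun h => b.2 (h ▸ a.2)), add_zero]
  · rw [Matrix.submatrix_apply, Equiv.sumCompl_apply_inr, Equiv.sumCompl_apply_inl, Matrix.fromBlocks_apply₂₁,
      Matrix.of_apply, hsum, if_neg (show ¬ (λ₁ a.1 = 0 ∧ λ₁ b.1 = 0) from fun h => a.2 h.1), Matrix.zero_apply,
      if_neg (show ¬ (a.1 = b.1) from fun h => a.2 (h ▸ b.2)), add_zero]
  · rw [Matrix.submatrix_apply, Equiv.sumCompl_apply_inr, Equiv.sumCompl_apply_inr, Matrix.fromBlocks_apply₂₂,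
      Matrix.of_apply, hsum, if_neg (show ¬ (λ₁ a.1 = 0 ∧ λ₁ b.1 = 0) from fun h => a.2 h.1), add_zero,
      Matrix.diagonal_apply]
    by_cases hab : a = b
    · subst hab
      rw [if_pos rfl, if_pos rfl]
    · rw [if_neg (fun h => hab (Subtype.ext h)), if_neg hab]

/-- **The indices of `K(0)`**: `ν(K(0)) = ν(S_{l₁}) + ν(D)`, `π(K(0)) = π(S_{l₁}) + π(D)` (`det D ≠ 0`). [folklore] -/
theorem indices_K_zero (h12 : d l₂ < d l₁) (hsec : ∀ l, l ≠ l₁ → l ≠ l₂ → d l < d l₂) (hDu : IsUnit (𝔻).det) :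
    Fintype.card {j // (isHermitian_K d S hS l₁ l₂ 0).eigenvalues j < 0}
        = Fintype.card {j // (hS l₁).eigenvalues j < 0} + Fintype.card {j // (isHermitian_compression S hS l₁ l₂).eigenvalues j < 0}
      ∧ Fintype.card {j // 0 < (isHermitian_K d S hS l₁ l₂ 0).eigenvalues j}
        = Fintype.card {j // 0 < (hS l₁).eigenvalues j} + Fintype.card {j // 0 < (isHermitian_compression S hS l₁ l₂).eigenvalues j} := by
  classical
  set e := Equiv.sumCompl fun i : Fin m => λ₁ i = 0 with he
  have hK := isHermitian_K d S hS l₁ l₂ 0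
  have hKs : ((𝕂[(0 : ℝ)]).submatrix e e).IsHermitian := hK.submatrix _
  have hdiagH : (Matrix.diagonal fun i : {i : Fin m // ¬ λ₁ i = 0} => λ₁ i.1).IsHermitian :=
    isHermitian_of_isSymm (Matrix.isSymm_diagonal _)
  have hD := isHermitian_compression S hS l₁ l₂
  have heq := K_zero_submatrix d S hS l₁ l₂ h12 hsec
  have hB : (Matrix.fromBlocks (𝔻) 0 0 (Matrix.diagonal fun i : {i : Fin m // ¬ λ₁ i = 0} => λ₁ i.1)).IsHermitian := by
    rw [← heq]; exact hKs
  have hDs : (𝔻).IsSymm := (isSymm_eigU_conj S hS l₁ l₂).submatrix _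
  -- counting the signed eigenvalues off `Z`
  have hneg : Fintype.card {i : {i : Fin m // ¬ λ₁ i = 0} // λ₁ i.1 < 0} = Fintype.card {j // (hS l₁).eigenvalues j < 0} :=
    Fintype.card_congr
      { toFun := fun x => ⟨x.1.1, x.2⟩
        invFun := fun y => ⟨⟨y.1, y.2.ne⟩, y.2⟩
        left_inv := fun x => rfl
        right_inv := fun y => rfl }
  have hposc : Fintype.card {i : {i : Fin m // ¬ λ₁ i = 0} // 0 < λ₁ i.1} = Fintype.card {j // 0 < (hS l₁).eigenvalues j} :=
    Fintype.card_congr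
      { toFun := fun x => ⟨x.1.1, x.2⟩
        invFun := fun y => ⟨⟨y.1, y.2.ne'⟩, y.2⟩
        left_inv := fun x => rfl
        right_inv := fun y => rfl }
  constructor
  · rw [← negIndex_submatrix_equiv hK e hKs, negIndex_congr hKs hB heq, negIndex_fromBlocks_diag hDs hDu hD hdiagH hB,
      GramDual.negIndex_diagonal _ hdiagH, hneg, add_comm]
  · rw [← posIndex_submatrix_equiv hK e hKs, posIndex_congr hKs hB heq, posIndex_fromBlocks_diag hDs hDu hD hdiagH hB,
      GramDual.posIndex_diagonal _ hdiagH, hposc, add_comm]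

/-- `K(0)` is non-singular when `D` is. [folklore] -/
theorem det_K_zero_ne_zero (h12 : d l₂ < d l₁) (hsec : ∀ l, l ≠ l₁ → l ≠ l₂ → d l < d l₂) (hDu : IsUnit (𝔻).det) :
    (𝕂[(0 : ℝ)]).det ≠ 0 := by
  classical
  obtain ⟨hν, hπ⟩ := indices_K_zero d S hS l₁ l₂ h12 hsec hDu
  refine det_ne_zero_of_indices (isHermitian_K d S hS l₁ l₂ 0) ?_
  rw [hν, hπ]
  have hD := (negIndex_add_posIndex_add_corank (isHermitian_compression S hS l₁ l₂)).1
  rw [corank_eq_zero_of_det_ne_zero hDu.ne_zero, add_zero] at hD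
  have h1 := (negIndex_add_posIndex_add_corank (hS l₁)).1
  have hrank := (hS l₁).rank_eq_card_non_zero_eigs
  have hc := Fintype.card_subtype_compl (fun i : Fin m => λ₁ i = 0)
  have hle : Fintype.card {i : Fin m // λ₁ i = 0} ≤ Fintype.card (Fin m) := Fintype.card_subtype_le _
  have hne : Fintype.card {i : Fin m // (hS l₁).eigenvalues i ≠ 0} = Fintype.card {i : Fin m // ¬ λ₁ i = 0} := rfl
  omega

/-! ## §3  The congruences: `K(s) = Λ (UᵀG(s)U) Λ`, `G(s) = x^{−d_{l₁}}F(x)` -/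

/-- `UᵀG(s)U = diag λ + Σ_{l ≠ l₁} s^{2(d_{l₁}−d_l)} UᵀS_lU`. [folklore] -/
theorem conj_rescaledPencil (s : ℝ) :
    (𝕌₁)ᵀ * 𝔾[s] * 𝕌₁
      = Matrix.diagonal (λ₁) + ∑ l ∈ Finset.univ.erase l₁, s ^ (2 * (d l₁ - d l)) • ((𝕌₁)ᵀ * S l * 𝕌₁) := by
  classical
  have hsplit : 𝔾[s] = S l₁ + ∑ l ∈ Finset.univ.erase l₁, s ^ (2 * (d l₁ - d l)) • S l := by
    rw [← Finset.add_sum_erase Finset.univ (fun l => s ^ (2 * (d l₁ - d l)) • S l) (Finset.mem_univ l₁)]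
    simp only [Nat.sub_self, mul_zero, pow_zero, one_smul]
  rw [hsplit, Matrix.mul_add, Matrix.add_mul, eigU_conj_top S hS l₁, Matrix.mul_sum, Finset.sum_mul]
  congr 1
  refine Finset.sum_congr rfl fun l _ => ?_
  rw [Matrix.mul_smul, Matrix.smul_mul]

/-- Powers bookkeeping: `s^{2a − zᵢ − zⱼ} = (s^{zᵢ})⁻¹ · s^{2a} · (s^{zⱼ})⁻¹` when `zᵢ, zⱼ ≤ g ≤ a`, `s ≠ 0`. [folklore] -/
theorem pow_sub_sub_eq {s : ℝ} (hs : s ≠ 0) {a g zi zj : ℕ} (ha : g ≤ a) (hzi : zi ≤ g) (hzj : zj ≤ g) :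
    s ^ (2 * a - zi - zj) = (s ^ zi)⁻¹ * s ^ (2 * a) * (s ^ zj)⁻¹ := by
  rw [pow_sub₀ _ hs (by omega : zj ≤ 2 * a - zi), pow_sub₀ _ hs (by omega : zi ≤ 2 * a)]
  ring

/-- **`K(s) = Λ (UᵀG(s)U) Λ`** for `s ≠ 0`, `Λ = diag((s^{zᵢ})⁻¹)`, `zᵢ = g·[λᵢ = 0]`. [folklore] -/
theorem K_eq_conj (h12 : d l₂ < d l₁) (hsec : ∀ l, l ≠ l₁ → l ≠ l₂ → d l < d l₂) {s : ℝ} (hs : s ≠ 0) :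
    𝕂[s] = Matrix.diagonal (fun i => (s ^ (if λ₁ i = 0 then 𝕘 else 0))⁻¹) * ((𝕌₁)ᵀ * 𝔾[s] * 𝕌₁)
      * Matrix.diagonal (fun i => (s ^ (if λ₁ i = 0 then 𝕘 else 0))⁻¹) := by
  classical
  rw [conj_rescaledPencil d S hS l₁ s]
  ext i j
  rw [Matrix.mul_diagonal, Matrix.diagonal_mul, Matrix.of_apply, Matrix.add_apply, Matrix.diagonal_apply,
    Matrix.sum_apply]
  simp only [Matrix.smul_apply, smul_eq_mul]
  rw [mul_add, add_mul, Finset.mul_sum, Finset.sum_mul]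
  congr 1
  · by_cases hij : i = j
    · subst hij
      rw [if_pos rfl]
      by_cases hz : λ₁ i = 0
      · rw [hz]; ring
      · rw [if_neg hz, pow_zero, inv_one]; ring
    · rw [if_neg hij]; ring
  · refine Finset.sum_congr rfl fun l hl => ?_
    have hl1 : l ≠ l₁ := (Finset.mem_erase.1 hl).1
    have ha : 𝕘 ≤ d l₁ - d l := by
      by_cases hl2 : l = l₂
      · rw [hl2]
      · have := hsec l hl1 hl2; omega
    have hzi : (if λ₁ i = 0 then 𝕘 else 0) ≤ 𝕘 := by split_ifs <;> omega
    have hzj : (if λ₁ j = 0 then 𝕘 else 0) ≤ 𝕘 := by split_ifs <;> omega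
    rw [pow_sub_sub_eq hs ha hzi hzj]
    ring

/-- **`UᵀG(s)U = Λ′ K(s) Λ′`**, `Λ′ = diag(s^{zᵢ})` — the inverse congruence. [folklore] -/
theorem conj_eq_K (h12 : d l₂ < d l₁) (hsec : ∀ l, l ≠ l₁ → l ≠ l₂ → d l < d l₂) {s : ℝ} (hs : s ≠ 0) :
    (𝕌₁)ᵀ * 𝔾[s] * 𝕌₁ = Matrix.diagonal (fun i => s ^ (if λ₁ i = 0 then 𝕘 else 0)) * 𝕂[s]
      * Matrix.diagonal (fun i => s ^ (if λ₁ i = 0 then 𝕘 else 0)) := by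
  set Λ : Matrix (Fin m) (Fin m) ℝ := Matrix.diagonal (fun i => (s ^ (if λ₁ i = 0 then 𝕘 else 0))⁻¹) with hΛ
  set Λ' : Matrix (Fin m) (Fin m) ℝ := Matrix.diagonal (fun i => s ^ (if λ₁ i = 0 then 𝕘 else 0)) with hΛ'
  set M : Matrix (Fin m) (Fin m) ℝ := (𝕌₁)ᵀ * 𝔾[s] * 𝕌₁ with hMdef
  have hcancel : Λ' * Λ = 1 := by
    rw [hΛ, hΛ', Matrix.diagonal_mul_diagonal, ← Matrix.diagonal_one]
    congr 1; funext i; exact mul_inv_cancel₀ (pow_ne_zero _ hs)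
  have hcancel' : Λ * Λ' = 1 := by
    rw [hΛ, hΛ', Matrix.diagonal_mul_diagonal, ← Matrix.diagonal_one]
    congr 1; funext i; exact inv_mul_cancel₀ (pow_ne_zero _ hs)
  have hK : 𝕂[s] = Λ * M * Λ := K_eq_conj d S hS l₁ l₂ h12 hsec hs
  rw [hK]
  have hre : Λ' * (Λ * M * Λ) * Λ' = (Λ' * Λ) * M * (Λ * Λ') := by simp only [Matrix.mul_assoc]
  rw [hre, hcancel, hcancel', Matrix.one_mul, Matrix.mul_one]

/-- **`G(s) = x^{−d_{l₁}}F(x)`** at `x > 0`, `s = (√x)⁻¹` (all `d_l ≤ d_{l₁}`). [folklore] -/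
theorem rescaledPencil_eq_smul (hle : ∀ l, d l ≤ d l₁) {x : ℝ} (hx : 0 < x) :
    𝔾[(Real.sqrt x)⁻¹] = (x ^ d l₁)⁻¹ • ∑ l, x ^ d l • S l := by
  rw [Finset.smul_sum]
  refine Finset.sum_congr rfl fun l _ => ?_
  rw [smul_smul]
  congr 1
  have hs2 : ((Real.sqrt x)⁻¹) ^ 2 = x⁻¹ := by rw [inv_pow, Real.sq_sqrt hx.le]
  rw [pow_mul, hs2, inv_pow]
  have hsplit : x ^ d l₁ = x ^ (d l₁ - d l) * x ^ d l := by rw [← pow_add, Nat.sub_add_cancel (hle l)]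
  rw [hsplit, mul_inv, mul_assoc, inv_mul_cancel₀ (pow_ne_zero _ hx.ne'), mul_one]

end FlagTwoStep

end Inertia

end Summit.ValiantsHypothesis.ValiantsHypothesis.Theorems.LacunarySymmetroidMatrixDescartes
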